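import Literature.MathematicalPhysics.QuantumLattice.TranslationInvariantGroundStates
import Literature.MathematicalPhysics.QuantumLattice.InfiniteVolumeStatesDerivationProofs
import Literature.MathematicalPhysics.QuantumLattice.InfiniteVolumeShiftProofs
import Literature.MathematicalPhysics.QuantumLattice.TranslationInvariantGroundStatesAreMeanEnergyMinimisers
import HarnessLib

/-!
# Translation-invariant ground states of quantum SPIN systems minimise the mean energy
# (Bratteli–Kishimoto–Robinson 1978, Theorem 2, direction `1 ⇒ 2`), for every finite-range
# translation-invariant interaction on `ℤ^d`

Topic `Literature/MathematicalPhysics/QuantumLattice`; namespace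
`Literature.MathematicalPhysics.QuantumLattice` (the file path). Vocabulary of
`InfiniteVolumeStates.lean` (quantum SPIN systems on `ℤ^d` with local dimension `q`: `Op ↥Λ q`,
`embedOp`, `InfVolState`, `InfVolState.shift`, `InfVolState.IsTranslationInvariant`, `thicken`,
`derivation`, `InfVolState.IsGroundState` = the LOCAL Bratteli–Robinson ground-state condition
`-i ω(A⋆ δ(A)) ≥ 0`; `LatticeInteraction`, `HasFiniteRange`, `IsTranslationInvariant`) and of
`TranslationInvariantGroundStates.lean` (`meanEnergyObs Φ R = Σ_{X ∋ 0} Φ(X)/|X|`,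
`InfVolState.meanEnergy`, `InfVolState.IsMeanEnergyMinimiser`, and the NAMED FACT
`BratteliKishimotoRobinson1978_theorem2`). Everything here is PROVED; no named fact. This file is the
spin-system twin of the tree's `TranslationInvariantGroundStatesAreMeanEnergyMinimisers.lean` (lattice
FERMIONS, `InfVolFermionState`), whose model-free lattice-geometry lemmas (`thicken_singleton_eq`,
`card_thicken_halfOpenBox_sdiff_le`, `sum_sum_filter_mem_eq_sum_card_inter_smul`,
`sum_filter_not_subset_le_sum_sdiff_sum`, `sum_thicken_singleton_eq_sum_shiftSet`, …) it imports and
reuses; it is one half of the discharge of `BratteliKishimotoRobinson1978_theorem2` (the other half,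
`2 ⇒ 1`, is `SpinMeanEnergyMinimisersAreGroundStates.lean`).

## Main results

Let `Φ` be a TRANSLATION-INVARIANT interaction of FINITE RANGE `R` on the quantum spin system `ℤ^d`
(any `d`, any local dimension `q`), and `S_Φ := Σ_{X ∋ 0, X ⊆ Λ_R(0)} ‖Φ X‖` (`Λ_R(0) = thicken {0} R`).

* §1 `InfVolState.re_expect_le_of_localStability_of_decomp` — **Bratteli–Kishimoto–Robinson's
  principle of minimum local energy (their Theorem 1, `2 ⇒ 1`), product-state case, operator form**:
  if `ω` is locally `H`-stable on `Λ ⊆ Λ'` (`Re ω((A ⊗ 𝟙)⋆[H, A ⊗ 𝟙]) ≥ 0` for all `A ∈ 𝔄_Λ`) and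
  `H = H_in ⊗ 𝟙 + H_far + H_×` with `H_far` commuting with `𝔄_Λ ⊗ 𝟙`, then
  `Re ω_Λ(H_in) ≤ Re σ_Λ(H_in) + 2‖H_×‖` for EVERY state `σ` (sum the ground-state inequality over the
  Kraus family `√ρ_Λ^σ · e_{ts}` of the density matrix `ρ_Λ^σ` of `σ`, `InfVolState.rdm`); and
  `InfVolState.expect_commutator_eq_zero_of_localStability` (local stability ⇒ stationarity).
* §2 `InfVolState.IsGroundState.re_expect_localHamiltonian_le` — for a ground state `ω` of `Φ`:
  `Re ω(H_Λ) ≤ Re σ(H_Λ) + 2 ‖W_Λ‖` for every finite `Λ` and every state `σ`, `W_Λ` the interaction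
  across `∂Λ` (locality: the terms away from `Λ` commute with `𝔄_Λ ⊗ 𝟙`, `commute_embedOp_of_disjoint`).
* §3 `InfVolState.IsTranslationInvariant.abs_card_mul_meanEnergy_sub_le` — **the mean energy versus
  the free-boundary local Hamiltonians** (Bratteli–Robinson II §6.2.4):
  `| |Λ|·e_Φ(ω) − (Re ω(H_Λ) − Re ω(Φ ∅)) | ≤ |thicken Λ R ∖ Λ| · S_Φ` for translation-invariant `ω`
  (behind it the exact identity `|Λ| ω(E_Φ) = Σ_{Y ⊆ thicken Λ R} |Y ∩ Λ| |Y|⁻¹ ω(Φ Y)`,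
  `card_mul_expect_meanEnergyObs_eq`), and `LatticeInteraction.IsTranslationInvariant.norm_crossSum_le`:
  `‖W_Λ‖ ≤ |thicken Λ R ∖ Λ| · S_Φ`.
* §4 `InfVolState.IsGroundState.isMeanEnergyMinimiser` — **every translation-invariant ground state
  of a translation-invariant finite-range interaction minimises the mean energy** among the
  translation-invariant states (on the boxes `[0,L)^d` the collar has `≤ (L+2⌊R⌋)^d − L^d = o(L^d)`
  sites, `L → ∞`). No Hermiticity and no restriction on `d` or `q` is needed for this direction.

## Source, and what is printed (held text `paper:doi-10-1007-bf01940760`, pp. 47–48 read)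

O. Bratteli, A. Kishimoto, D. W. Robinson, *Ground states of quantum spin systems*, Commun. Math.
Phys. **64** (1978) 41–48 [BratteliKishimotoRobinson1978]. Theorem 2 (p. 47): "Let `Φ` be a
`ℤ^ν`-invariant interaction such that `‖Φ‖_λ = Σ_{X∋0} ‖Φ(X)‖ e^{λ|X|} < +∞` for some `λ > 0` and let
`τ^Φ` denote the associated dynamical group. If `ω` is a `ℤ^ν`-invariant state the following are
equivalent: 1. `ω` is a `τ^Φ`-ground state, 2. `ω` minimizes `H_Φ`." Proof of `1 ⇒ 2` (pp. 47–48):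
Theorem 1 gives `ω(H̃_Φ(Λ)) ≤ ω'(H̃_Φ(Λ))` for `ω' ∈ C_Λ^ω`; for a `ℤ^ν`-invariant `σ` take
`ω' = σ|_Λ ⊗ ω|_{Λᶜ}`, so "`ω(H_Φ(Λ)) ≤ σ(H_Φ(Λ)) + ω'(W_Φ(Λ)) − ω(W_Φ(Λ))` with
`W_Φ(Λ) = H̃_Φ(Λ) − H_Φ(Λ)`. Dividing both sides by `|Λ|` and using `lim ‖W_Φ(Λ)‖/|Λ| = 0` where
`Λ → ∞` in the sense of van Hove, one finds `H_Φ(ω) ≤ H_Φ(σ)`." HERE: finite range instead of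
`‖Φ‖_λ < ∞` (weaker than print, never stronger); the mean energy `H_Φ(ω) = lim ω(H_Φ(Λ))/|Λ|` of an
invariant state is `ω(E_Φ)` (Bratteli–Robinson II §6.2.4), §3 is the finite-range free-boundary form
of that identity with an explicit collar error; the product-state step of Theorem 1 is done directly by
summing the ground-state inequality over the Kraus family of the conditional expectation onto `σ_Λ`
(`Σ A_k⋆ A_k = 1`, `Σ A_k⋆ Z A_k = σ_Λ(Z)1`), exactly as in the tree's fermionic
`FermionGroundStatesMinimiseMeanEnergy.lean` §1 (spins: plain locality replaces graded locality).
Restated: Bratteli–Robinson II Thm. 6.2.58 [BratteliRobinsonII1997]; Koma–Tasaki, J. Stat. Phys. 76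
(1994) App. A.

HONEST SCOPE: model-free statements about states and interactions of the tree's spin-system
framework; nothing is claimed about the existence or structure of ground states of any model.
-/

noncomputable section

namespace Literature.MathematicalPhysics.QuantumLattice

open Matrix Finset Literature.Probability.LatticeModels _root_.Filter
open scoped ComplexOrder _root_.Topology

variable {d q : ℕ}

/-! ### §0. Toolkit: isotony and transport are norm-contractive; the density matrix of a local state -/

/-- The isotony embedding `𝔄_Λ → 𝔄_{Λ'}`, `A ↦ A ⊗ 𝟙_{Λ'∖Λ}`, as a `⋆`-algebra homomorphism
(`embedOp` is unital, multiplicative, linear and `⋆`-preserving: `embedOp_one/mul/add/smul`,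
`embedOp_conjTranspose`). [cite: BratteliRobinsonII1997, §6.2.1 (isotony)] -/
def embedOpStarAlgHom {Λ Λ' : Finset (Site d)} (h : Λ ⊆ Λ') : Op ↥Λ q →⋆ₐ[ℂ] Op ↥Λ' q where
  toFun := embedOp h
  map_one' := embedOp_one h
  map_mul' := embedOp_mul h
  map_zero' := embedOp_zero h
  map_add' := embedOp_add h
  commutes' c := by
    rw [Algebra.algebraMap_eq_smul_one, Algebra.algebraMap_eq_smul_one, embedOp_smul, embedOp_one]
  map_star' A := by
    change embedOp h (star A) = star (embedOp h A)
    rw [Matrix.star_eq_conjTranspose, Matrix.star_eq_conjTranspose, embedOp_conjTranspose]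

/-- `embedOpStarAlgHom h` is `embedOp h`. [cite: BratteliRobinsonII1997, §6.2.1 (isotony)] -/
@[simp] theorem embedOpStarAlgHom_apply {Λ Λ' : Finset (Site d)} (h : Λ ⊆ Λ') (A : Op ↥Λ q) :
    embedOpStarAlgHom h A = embedOp h A := rfl

open scoped Matrix.Norms.L2Operator in
/-- **Isotony is norm-contractive**: `‖A ⊗ 𝟙‖ ≤ ‖A‖` (L²-operator norm) — a `⋆`-homomorphism between
C⋆-algebras does not increase norms. [cite: BratteliRobinsonII1997, §6.2.1 (isotony is isometric)] -/
theorem norm_embedOp_le {Λ Λ' : Finset (Site d)} (h : Λ ⊆ Λ') (A : Op ↥Λ q) :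
    ‖embedOp h A‖ ≤ ‖A‖ := by
  letI : CStarAlgebra (Op ↥Λ q) := {}
  letI : CStarAlgebra (Op ↥Λ' q) := {}
  exact NonUnitalStarAlgHom.norm_apply_le (embedOpStarAlgHom h) A

/-- Transport of configuration matrices along a relabelling of sites, as a `⋆`-algebra homomorphism
(it is Mathlib's `Matrix.reindexAlgEquiv`, and commutes with the adjoint).
[cite: BratteliRobinsonII1997, §6.2.1 (covariance)] -/
def transportOpStarAlgHom {X Y : Type*} [Fintype X] [DecidableEq X] [Fintype Y] [DecidableEq Y]
    (e : X ≃ Y) : Matrix (X → Fin q) (X → Fin q) ℂ →⋆ₐ[ℂ] Matrix (Y → Fin q) (Y → Fin q) ℂ :=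
  { (Matrix.reindexAlgEquiv ℂ ℂ (e.arrowCongr (Equiv.refl (Fin q)))).toAlgHom with
    map_star' := fun A => by
      change transportOp e (star A) = star (transportOp e A)
      rw [Matrix.star_eq_conjTranspose, Matrix.star_eq_conjTranspose, transportOp_conjTranspose] }

/-- `transportOpStarAlgHom e` is `transportOp e`. [cite: BratteliRobinsonII1997, §6.2.1 (covariance)] -/
@[simp] theorem transportOpStarAlgHom_apply {X Y : Type*} [Fintype X] [DecidableEq X] [Fintype Y]
    [DecidableEq Y] (e : X ≃ Y) (A : Matrix (X → Fin q) (X → Fin q) ℂ) :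
    transportOpStarAlgHom e A = transportOp e A := rfl

open scoped Matrix.Norms.L2Operator in
/-- **Transport is norm-contractive** (in fact isometric): `‖τ_e A‖ ≤ ‖A‖`.
[cite: BratteliRobinsonII1997, §6.2.1 (covariance by `*`-isomorphisms)] -/
theorem norm_transportOp_le {X Y : Type*} [Fintype X] [DecidableEq X] [Fintype Y] [DecidableEq Y]
    (e : X ≃ Y) (A : Matrix (X → Fin q) (X → Fin q) ℂ) : ‖transportOp e A‖ ≤ ‖A‖ := by
  letI : CStarAlgebra (Matrix (X → Fin q) (X → Fin q) ℂ) := {}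
  letI : CStarAlgebra (Matrix (Y → Fin q) (Y → Fin q) ℂ) := {}
  exact NonUnitalStarAlgHom.norm_apply_le (transportOpStarAlgHom e) A

namespace InfVolState

variable (ω : InfVolState d q)

open scoped Matrix.Norms.L2Operator in
/-- Real-part form of contractivity: `|Re ω_Λ(A)| ≤ ‖A‖`. [cite: BratteliRobinsonI1987, Prop. 2.3.11] -/
theorem abs_re_expect_le (Λ : Finset (Site d)) (A : Op ↥Λ q) : |(ω.expect Λ A).re| ≤ ‖A‖ :=
  (Complex.abs_re_le_norm _).trans (ω.norm_expect_le_holds Λ A)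

/-- **The density matrix `ρ_Λ` of the local state `ω_Λ`**: `(ρ_Λ)_{s t} = ω_Λ(|t⟩⟨s|)`, the unique
matrix with `ω_Λ(A) = Tr(ρ_Λ A)` (`trace_rdm_mul`). Bratteli–Robinson I, §2.6 (after Def. 2.6.6):
`ω(A) = Tr(ρ_α A)`, `A ∈ 𝔐_α`. [cite: BratteliRobinsonI1987, §2.6, display after Def. 2.6.6] -/
def rdm (Λ : Finset (Site d)) : Op ↥Λ q :=
  fun s t => ω.expect Λ (Matrix.single t s 1)

/-- The entries of the density matrix (definitional). [cite: BratteliRobinsonI1987, §2.6] -/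
theorem rdm_apply (Λ : Finset (Site d)) (s t : TensorIndex ↥Λ q) :
    ω.rdm Λ s t = ω.expect Λ (Matrix.single t s 1) := rfl

/-- **`ω_Λ(A) = Tr(ρ_Λ A)`.** [cite: BratteliRobinsonI1987, §2.6] -/
theorem trace_rdm_mul (Λ : Finset (Site d)) (A : Op ↥Λ q) :
    (ω.rdm Λ * A).trace = ω.expect Λ A := by
  conv_rhs => rw [Matrix.matrix_eq_sum_single A, map_sum]
  simp only [map_sum]
  rw [Matrix.trace]
  simp only [Matrix.diag_apply, Matrix.mul_apply, rdm_apply]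
  rw [Finset.sum_comm]
  refine Finset.sum_congr rfl fun s _ => Finset.sum_congr rfl fun t _ => ?_
  rw [mul_comm, ← smul_eq_mul, ← map_smul, Matrix.smul_single, smul_eq_mul, mul_one]

/-- **`ρ_Λ` is Hermitian.** [cite: BratteliRobinsonI1987, §2.6 (density matrix)] -/
theorem rdm_isHermitian (ω : InfVolState d q) (Λ : Finset (Site d)) : (ω.rdm Λ).IsHermitian := by
  ext s t
  rw [Matrix.conjTranspose_apply, rdm_apply, rdm_apply, ← ω.expect_conjTranspose_holds]
  congr 1
  ext u v
  rw [Matrix.conjTranspose_apply, Matrix.single_apply, Matrix.single_apply]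
  by_cases h : s = v ∧ t = u
  · rw [if_pos h, if_pos ⟨h.2, h.1⟩, star_one]
  · rw [if_neg h, if_neg (fun h' => h ⟨h'.2, h'.1⟩), star_zero]

/-- **`ρ_Λ` is positive semidefinite**: `x̄ᵀ ρ_Λ x = ω(Cᴴ C) ≥ 0` for the one-row matrix
`C = Σ_s conj(x_s) |i₀⟩⟨s|` (any fixed row index `i₀`; an empty index set is trivial).
[cite: BratteliRobinsonI1987, §2.6 (density matrix)] -/
theorem rdm_posSemidef (ω : InfVolState d q) (Λ : Finset (Site d)) : (ω.rdm Λ).PosSemidef := by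
  refine Matrix.PosSemidef.of_dotProduct_mulVec_nonneg (ω.rdm_isHermitian Λ) fun x => ?_
  rcases isEmpty_or_nonempty (TensorIndex ↥Λ q) with hE | ⟨⟨i₀⟩⟩
  · rw [dotProduct, Finset.univ_eq_empty, Finset.sum_empty]
  set C : Op ↥Λ q := ∑ s, star (x s) • Matrix.single i₀ s (1 : ℂ) with hC
  have hCC : Cᴴ * C = ∑ s, ∑ t, (star (x s) * x t) • Matrix.single t s (1 : ℂ) := by
    simp only [hC, Matrix.conjTranspose_sum, Matrix.conjTranspose_smul, Matrix.conjTranspose_single,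
      star_star, star_one, Finset.sum_mul, Finset.mul_sum, Matrix.smul_mul, Matrix.mul_smul,
      Matrix.single_mul_single_same, smul_smul, mul_one]
  have hq : star x ⬝ᵥ (ω.rdm Λ *ᵥ x) = ω.expect Λ (Cᴴ * C) := by
    rw [hCC, map_sum]
    simp only [map_sum, map_smul, smul_eq_mul, dotProduct, Matrix.mulVec, Pi.star_apply,
      Finset.mul_sum, rdm_apply]
    refine Finset.sum_congr rfl fun s _ => Finset.sum_congr rfl fun t _ => ?_
    ring
  rw [hq]
  exact ω.expect_nonneg Λ C

/-! ### §1. Local stability summed over a Kraus family -/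

section Kraus

variable {Λ Λ' : Finset (Site d)} (hΛ : Λ ⊆ Λ')

/-- **Local stability summed over a Kraus family.** If `Re ω((ΓA)⋆(H ΓA − ΓA H)) ≥ 0` for every
`A ∈ 𝔄_Λ` (`Γ = embedOp`, the isotony `𝔄_Λ → 𝔄_{Λ'}`; this is the Bratteli–Robinson ground-state
inequality `-i ω(A⋆δ(A)) ≥ 0` for `δ = i[H, ·]`), then for every finite family `A_k ∈ 𝔄_Λ` with
`Σ_k A_k⋆ A_k = 1`: `Re ω(H) ≤ Re ω(Σ_k (ΓA_k)⋆ H (ΓA_k))`.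
[cite: BratteliKishimotoRobinson1978, Thm. 1 (pp. 43–44)] -/
theorem re_expect_le_re_expect_sum_conj_of_localStability {H : Op ↥Λ' q}
    (hstab : ∀ A : Op ↥Λ q,
      0 ≤ (ω.expect Λ' ((embedOp hΛ A)ᴴ * (H * embedOp hΛ A - embedOp hΛ A * H))).re)
    {ι : Type*} (s : Finset ι) (A : ι → Op ↥Λ q) (hA : ∑ k ∈ s, (A k)ᴴ * A k = 1) :
    (ω.expect Λ' H).re ≤
      (ω.expect Λ' (∑ k ∈ s, (embedOp hΛ (A k))ᴴ * H * embedOp hΛ (A k))).re := by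
  have hunit : ∑ k ∈ s, (embedOp hΛ (A k))ᴴ * embedOp hΛ (A k) = 1 := by
    simp_rw [← embedOp_conjTranspose, ← embedOp_mul]
    rw [← embedOp_sum, hA, embedOp_one]
  have hsum : ∑ k ∈ s, (ω.expect Λ' ((embedOp hΛ (A k))ᴴ *
        (H * embedOp hΛ (A k) - embedOp hΛ (A k) * H))).re =
      (ω.expect Λ' (∑ k ∈ s, (embedOp hΛ (A k))ᴴ * H * embedOp hΛ (A k))).re -
        (ω.expect Λ' H).re := by
    have hterm : ∀ k ∈ s, (embedOp hΛ (A k))ᴴ * (H * embedOp hΛ (A k) - embedOp hΛ (A k) * H) =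
        (embedOp hΛ (A k))ᴴ * H * embedOp hΛ (A k) -
          (embedOp hΛ (A k))ᴴ * embedOp hΛ (A k) * H :=
      fun k _ => by rw [Matrix.mul_sub, Matrix.mul_assoc, Matrix.mul_assoc]
    have hmat : ∑ k ∈ s, (embedOp hΛ (A k))ᴴ * (H * embedOp hΛ (A k) - embedOp hΛ (A k) * H) =
        (∑ k ∈ s, (embedOp hΛ (A k))ᴴ * H * embedOp hΛ (A k)) - H := by
      rw [Finset.sum_congr rfl hterm, Finset.sum_sub_distrib, ← Finset.sum_mul, hunit, Matrix.one_mul]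
    rw [← Complex.re_sum, ← map_sum, hmat, map_sub, Complex.sub_re]
  have h := Finset.sum_nonneg fun k (_ : k ∈ s) => hstab (A k)
  rw [hsum] at h
  linarith

/-- The conjugation-sum map `Z ↦ Σ_k K_k⋆ Z K_k` fixes every `Z` commuting with all `K_k`, when
`Σ_k K_k⋆ K_k = 1`. [cite: BratteliRobinsonII1997, §6.2.1] -/
theorem sum_conj_eq_self_of_commute {ι : Type*} (s : Finset ι) (K : ι → Op ↥Λ' q)
    (hK : ∑ k ∈ s, (K k)ᴴ * K k = 1) {Z : Op ↥Λ' q} (hZ : ∀ k ∈ s, Commute Z (K k)) :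
    ∑ k ∈ s, (K k)ᴴ * Z * K k = Z := by
  have hterm : ∀ k ∈ s, (K k)ᴴ * Z * K k = (K k)ᴴ * K k * Z := fun k hk => by
    rw [Matrix.mul_assoc, (hZ k hk).eq, ← Matrix.mul_assoc]
  rw [Finset.sum_congr rfl hterm, ← Finset.sum_mul, hK, Matrix.one_mul]

open scoped MatrixOrder Matrix.Norms.L2Operator in
/-- **The conjugation-sum functional is contractive**: if `Σ_k K_k⋆ K_k = 1` in `𝔄_{Λ'}` then
`‖ω(Σ_k K_k⋆ Z K_k)‖ ≤ ‖Z‖` — `Z ↦ ω(Σ K_k⋆ Z K_k)` is a positive linear functional with value `1`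
at `1` (Bratteli–Robinson I Prop. 2.3.11, through the tree's
`PositiveLinearMap.norm_apply_le_of_map_one`). [cite: BratteliRobinsonI1987, Prop. 2.3.11] -/
theorem norm_expect_sum_conj_le {ι : Type*} (s : Finset ι) (K : ι → Op ↥Λ' q)
    (hK : ∑ k ∈ s, (K k)ᴴ * K k = 1) (Z : Op ↥Λ' q) :
    ‖ω.expect Λ' (∑ k ∈ s, (K k)ᴴ * Z * K k)‖ ≤ ‖Z‖ := by
  letI : CStarAlgebra (Op ↥Λ' q) := {}
  let f : Op ↥Λ' q →ₗ[ℂ] ℂ := (ω.expect Λ').comp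
    (∑ k ∈ s, (LinearMap.mulRight ℂ (K k)).comp (LinearMap.mulLeft ℂ (K k)ᴴ))
  have hf : ∀ Z, f Z = ω.expect Λ' (∑ k ∈ s, (K k)ᴴ * Z * K k) := fun Z => by
    simp only [f, LinearMap.comp_apply, LinearMap.sum_apply, LinearMap.mulRight_apply,
      LinearMap.mulLeft_apply]
  have hpos : ∀ Z, 0 ≤ Z → 0 ≤ f Z := fun Z hZ => by
    rw [hf, map_sum]
    refine Finset.sum_nonneg fun k _ => ω.expect_nonneg_of_nonneg Λ' ?_
    have h := star_left_conjugate_nonneg hZ (K k)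
    rwa [Matrix.star_eq_conjTranspose] at h
  have h1 : f 1 = 1 := by
    rw [hf]
    simp_rw [Matrix.mul_one]
    rw [hK, ω.expect_one]
  have h := Literature.MathematicalPhysics.QuantumLattice.PositiveLinearMap.norm_apply_le_of_map_one
    (.mk₀ f fun _ hB => hpos _ hB) h1 Z
  rw [← hf]
  exact h

open scoped MatrixOrder Matrix.Norms.L2Operator in
/-- Real-part form of the contractivity: `|Re ω(Σ_k K_k⋆ Z K_k)| ≤ ‖Z‖`.
[cite: BratteliRobinsonI1987, Prop. 2.3.11] -/
theorem abs_re_expect_sum_conj_le {ι : Type*} (s : Finset ι) (K : ι → Op ↥Λ' q)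
    (hK : ∑ k ∈ s, (K k)ᴴ * K k = 1) (Z : Op ↥Λ' q) :
    |(ω.expect Λ' (∑ k ∈ s, (K k)ᴴ * Z * K k)).re| ≤ ‖Z‖ :=
  (Complex.abs_re_le_norm _).trans (ω.norm_expect_sum_conj_le s K hK Z)

/-- The sum of the diagonal matrix units is the identity: `Σ_s e_{ss}(c) = c · 1`. [folklore] -/
private theorem sum_single_diag {n : Type*} [Fintype n] [DecidableEq n] (c : ℂ) :
    ∑ i : n, Matrix.single i i c = c • (1 : Matrix n n ℂ) := by
  ext a b
  simp only [Matrix.sum_apply, Matrix.single_apply, Matrix.smul_apply, Matrix.one_apply, smul_eq_mul]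
  by_cases hab : a = b
  · subst hab
    simp
  · rw [if_neg hab, mul_zero]
    exact Finset.sum_eq_zero fun i _ => if_neg fun h => hab (h.1.symm.trans h.2)

/-- **Kraus identity of a conjugation by matrix units**: for matrices `W, Z` over a finite index set,
`Σ_{s,t} (W e_{ts})⋆ Z (W e_{ts}) = Tr(W⋆ Z W) · 1`. [folklore] -/
private theorem sum_sum_conj_single (n : Type*) [Fintype n] [DecidableEq n] (W Z : Matrix n n ℂ) :
    ∑ s : n, ∑ t : n, (W * Matrix.single t s (1 : ℂ))ᴴ * Z * (W * Matrix.single t s 1) =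
      ((Wᴴ * Z * W).trace) • (1 : Matrix n n ℂ) := by
  have h1 : ∀ s t : n, (W * Matrix.single t s (1 : ℂ))ᴴ * Z * (W * Matrix.single t s 1) =
      Matrix.single s s ((Wᴴ * Z * W) t t) := by
    intro s t
    rw [Matrix.conjTranspose_mul, Matrix.conjTranspose_single, star_one,
      show Matrix.single s t (1 : ℂ) * Wᴴ * Z * (W * Matrix.single t s 1) =
        Matrix.single s t 1 * (Wᴴ * Z * W) * Matrix.single t s 1 by simp only [Matrix.mul_assoc],
      Matrix.single_mul_mul_single, one_mul, mul_one]
  simp_rw [h1]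
  rw [Finset.sum_comm]
  simp_rw [sum_single_diag, ← Finset.sum_smul]
  rfl

open scoped MatrixOrder in
/-- **The Kraus family of a state's density matrix.** For a state `σ` and a region `Λ` let
`W = √ρ_Λ` (`CFC.sqrt` of the density matrix `σ.rdm Λ`) and `A_{(s,t)} = W e_{ts}`. Then
`Σ_{s,t} A⋆ Z A = σ_Λ(Z) · 1` for every `Z ∈ 𝔄_Λ`: the Kraus form of the conditional expectation
`Z ↦ σ_Λ(Z) 1` onto `σ_Λ` (Bratteli–Kishimoto–Robinson's comparison state `ω' = σ_Λ ⊗ ω_{Λᶜ}`,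
Thm. 2 proof, p. 47, in Heisenberg form). [cite: BratteliKishimotoRobinson1978, Thm. 2 (proof, p. 47)] -/
theorem sum_conj_krausOfState (σ : InfVolState d q) (Λ : Finset (Site d)) (Z : Op ↥Λ q) :
    ∑ p : TensorIndex ↥Λ q × TensorIndex ↥Λ q,
        (CFC.sqrt (σ.rdm Λ) * Matrix.single p.2 p.1 (1 : ℂ))ᴴ * Z *
          (CFC.sqrt (σ.rdm Λ) * Matrix.single p.2 p.1 1) = σ.expect Λ Z • (1 : Op ↥Λ q) := by
  set W : Op ↥Λ q := CFC.sqrt (σ.rdm Λ) with hW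
  have h0 : (0 : Op ↥Λ q) ≤ σ.rdm Λ := Matrix.nonneg_iff_posSemidef.2 (σ.rdm_posSemidef Λ)
  have hWW : W * W = σ.rdm Λ := CFC.sqrt_mul_sqrt_self (σ.rdm Λ) h0
  have hWsa : Wᴴ = W := by
    rw [← Matrix.star_eq_conjTranspose]
    exact (CFC.sqrt_nonneg (σ.rdm Λ)).isSelfAdjoint.star_eq
  rw [Fintype.sum_prod_type, sum_sum_conj_single _ W Z, hWsa, Matrix.trace_mul_cycle, hWW,
    σ.trace_rdm_mul]

open scoped MatrixOrder in
/-- The Kraus family of a state is complete: `Σ_{s,t} A⋆ A = 1`.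
[cite: BratteliKishimotoRobinson1978, Thm. 2 (proof, p. 47)] -/
theorem sum_conjTranspose_mul_krausOfState (σ : InfVolState d q) (Λ : Finset (Site d)) :
    ∑ p : TensorIndex ↥Λ q × TensorIndex ↥Λ q,
        (CFC.sqrt (σ.rdm Λ) * Matrix.single p.2 p.1 (1 : ℂ))ᴴ *
          (CFC.sqrt (σ.rdm Λ) * Matrix.single p.2 p.1 1) = 1 := by
  have h := σ.sum_conj_krausOfState Λ 1
  simp_rw [Matrix.mul_one] at h
  rw [h, σ.expect_one, one_smul]

open scoped MatrixOrder Matrix.Norms.L2Operator in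
/-- **Bratteli–Kishimoto–Robinson's principle of minimum local energy, product-state case (operator
form).** Let `Λ ⊆ Λ'`, `H ∈ 𝔄_{Λ'}` and suppose `ω` is locally `H`-stable on `Λ`
(`Re ω((ΓA)⋆ [H, ΓA]) ≥ 0` for all `A ∈ 𝔄_Λ`, `Γ = embedOp`). If `H = Γ(H_in) + H_far + H_×` with
`H_far` commuting with every `Γ A`, `A ∈ 𝔄_Λ`, then for EVERY state `σ`:
`Re ω_Λ(H_in) ≤ Re σ_Λ(H_in) + 2 ‖H_×‖` — `ω` cannot lower its energy inside `Λ` by being replaced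
there by `σ_Λ` (the comparison state `σ_Λ ⊗ ω_{Λᶜ}`), up to the interaction across `∂Λ`.
[cite: BratteliKishimotoRobinson1978, Thm. 1 and Thm. 2 (proof, pp. 47–48)] -/
theorem re_expect_le_of_localStability_of_decomp (σ : InfVolState d q) {H : Op ↥Λ' q}
    (hstab : ∀ A : Op ↥Λ q,
      0 ≤ (ω.expect Λ' ((embedOp hΛ A)ᴴ * (H * embedOp hΛ A - embedOp hΛ A * H))).re)
    {Hin : Op ↥Λ q} {Hfar Hx : Op ↥Λ' q} (hH : H = embedOp hΛ Hin + Hfar + Hx)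
    (hfar : ∀ A : Op ↥Λ q, Commute Hfar (embedOp hΛ A)) :
    (ω.expect Λ Hin).re ≤ (σ.expect Λ Hin).re + 2 * ‖Hx‖ := by
  -- the Kraus family of `σ_Λ`, embedded by `Γ`
  let A : TensorIndex ↥Λ q × TensorIndex ↥Λ q → Op ↥Λ q := fun p =>
    CFC.sqrt (σ.rdm Λ) * Matrix.single p.2 p.1 (1 : ℂ)
  have hA1 : ∑ p, (A p)ᴴ * A p = 1 := σ.sum_conjTranspose_mul_krausOfState Λ
  have hK1 : ∑ p, (embedOp hΛ (A p))ᴴ * embedOp hΛ (A p) = 1 := by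
    simp_rw [← embedOp_conjTranspose, ← embedOp_mul]
    rw [← embedOp_sum, hA1, embedOp_one]
  -- the summed ground-state inequality
  have hmain := ω.re_expect_le_re_expect_sum_conj_of_localStability hΛ hstab Finset.univ A hA1
  -- the three parts of `Σ K⋆ H K`
  have hin : ∑ p, (embedOp hΛ (A p))ᴴ * embedOp hΛ Hin * embedOp hΛ (A p) =
      σ.expect Λ Hin • (1 : Op ↥Λ' q) := by
    simp_rw [← embedOp_conjTranspose, ← embedOp_mul]
    rw [← embedOp_sum, σ.sum_conj_krausOfState Λ Hin, embedOp_smul, embedOp_one]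
  have hfar' : ∑ p, (embedOp hΛ (A p))ᴴ * Hfar * embedOp hΛ (A p) = Hfar :=
    sum_conj_eq_self_of_commute Finset.univ (fun p => embedOp hΛ (A p)) hK1 fun p _ => hfar (A p)
  have hsplit : ∑ p, (embedOp hΛ (A p))ᴴ * H * embedOp hΛ (A p) =
      σ.expect Λ Hin • (1 : Op ↥Λ' q) + Hfar + ∑ p, (embedOp hΛ (A p))ᴴ * Hx * embedOp hΛ (A p) := by
    rw [← hin, ← hfar', ← Finset.sum_add_distrib, ← Finset.sum_add_distrib]
    refine Finset.sum_congr rfl fun p _ => ?_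
    rw [hH, Matrix.mul_add, Matrix.mul_add, Matrix.add_mul, Matrix.add_mul]
  -- expectations
  have hωH : (ω.expect Λ' H).re =
      (ω.expect Λ Hin).re + (ω.expect Λ' Hfar).re + (ω.expect Λ' Hx).re := by
    rw [hH, map_add, map_add, ω.compatible hΛ, Complex.add_re, Complex.add_re]
  have hωK : (ω.expect Λ' (∑ p, (embedOp hΛ (A p))ᴴ * H * embedOp hΛ (A p))).re =
      (σ.expect Λ Hin).re + (ω.expect Λ' Hfar).re +
        (ω.expect Λ' (∑ p, (embedOp hΛ (A p))ᴴ * Hx * embedOp hΛ (A p))).re := by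
    rw [hsplit, map_add, map_add, map_smul, ω.expect_one, Complex.add_re, Complex.add_re, smul_eq_mul,
      mul_one]
  have hx1 : (ω.expect Λ' (∑ p, (embedOp hΛ (A p))ᴴ * Hx * embedOp hΛ (A p))).re ≤ ‖Hx‖ :=
    (le_abs_self _).trans (ω.abs_re_expect_sum_conj_le Finset.univ (fun p => embedOp hΛ (A p)) hK1 Hx)
  have hx2 : -‖Hx‖ ≤ (ω.expect Λ' Hx).re := (abs_le.1 (ω.abs_re_expect_le Λ' Hx)).1
  rw [hωH, hωK] at hmain
  linarith

/-- **Local stability implies stationarity.** If `Re ω((ΓA)⋆ [H, ΓA]) ≥ 0` for every `A ∈ 𝔄_Λ`,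
then `ω([H, ΓB]) = 0` for every `B ∈ 𝔄_Λ`: apply the hypothesis to `A = B + λ·1`, for which
`[H, ΓA] = [H, ΓB]` and `(ΓA)⋆[H,ΓA] = (ΓB)⋆[H,ΓB] + conj(λ) [H,ΓB]`, and let `λ = -s·ω([H,ΓB])`,
`s → +∞`. Bratteli–Robinson II Prop. 5.3.19 ((1) ⇒ `ω ∘ δ = 0`).
[cite: BratteliRobinsonII1997, Prop. 5.3.19] -/
theorem expect_commutator_eq_zero_of_localStability {H : Op ↥Λ' q}
    (hstab : ∀ A : Op ↥Λ q,
      0 ≤ (ω.expect Λ' ((embedOp hΛ A)ᴴ * (H * embedOp hΛ A - embedOp hΛ A * H))).re)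
    (B : Op ↥Λ q) :
    ω.expect Λ' (H * embedOp hΛ B - embedOp hΛ B * H) = 0 := by
  set C : Op ↥Λ' q := H * embedOp hΛ B - embedOp hΛ B * H with hC
  set z : ℂ := ω.expect Λ' C with hz
  set c : ℝ := (ω.expect Λ' ((embedOp hΛ B)ᴴ * C)).re with hc
  -- the inequality for `A = B + λ 1`
  have key : ∀ lam : ℂ, 0 ≤ c + (star lam * z).re := by
    intro lam
    have h := hstab (B + lam • (1 : Op ↥Λ q))
    have hA : embedOp hΛ (B + lam • (1 : Op ↥Λ q)) = embedOp hΛ B + lam • (1 : Op ↥Λ' q) := by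
      rw [embedOp_add, embedOp_smul, embedOp_one]
    have hcomm : H * (embedOp hΛ B + lam • (1 : Op ↥Λ' q)) -
        (embedOp hΛ B + lam • (1 : Op ↥Λ' q)) * H = C := by
      rw [Matrix.mul_add, Matrix.add_mul, Matrix.mul_smul, Matrix.smul_mul, Matrix.mul_one,
        Matrix.one_mul, hC]
      abel
    rw [hA, hcomm, Matrix.conjTranspose_add, Matrix.conjTranspose_smul, Matrix.conjTranspose_one,
      Matrix.add_mul, Matrix.smul_mul, Matrix.one_mul, map_add, map_smul, Complex.add_re,
      smul_eq_mul] at h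
    exact h
  -- conclude `z = 0`
  by_contra hne
  have hzz : 0 < (star z * z).re := by
    rw [Complex.star_def, Complex.mul_re, Complex.conj_re, Complex.conj_im]
    have : z.re ≠ 0 ∨ z.im ≠ 0 := by
      by_contra h
      push Not at h
      exact hne (Complex.ext h.1 h.2)
    rcases this with h | h
    · nlinarith [sq_nonneg z.im, sq_pos_of_ne_zero h]
    · nlinarith [sq_nonneg z.re, sq_pos_of_ne_zero h]
  set r : ℝ := -((c + 1) / (star z * z).re) with hr
  have h := key ((r : ℂ) * z)
  have hre : (star ((r : ℂ) * z) * z).re = -(c + 1) := by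
    rw [star_mul', Complex.star_def, Complex.conj_ofReal, mul_assoc, Complex.re_ofReal_mul,
      ← Complex.star_def, hr, neg_mul, div_mul_cancel₀ _ hzz.ne']
  rw [hre] at h
  linarith

end Kraus

end InfVolState

/-! ### §2. Interactions: the local Hamiltonian near a subregion; ground states -/

namespace LatticeInteraction

variable (Φ : LatticeInteraction d q) {Λ Λ' : Finset (Site d)}

/-- **The local Hamiltonian of `Λ' ⊇ Λ` split along `Λ`**:
`H_{Λ'} = H_Λ ⊗ 𝟙 + Σ_{X ⊆ Λ', X ∩ Λ = ∅, X ⊄ Λ} Φ X ⊗ 𝟙 + Σ_{X ⊆ Λ', X ∩ Λ ≠ ∅, X ⊄ Λ} Φ X ⊗ 𝟙` —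
the terms inside `Λ`, the terms away from `Λ`, and the terms crossing `∂Λ`
(Bratteli–Kishimoto–Robinson's `H(Λ') = H_Φ(Λ) + (H(Λ') - H̃(Λ)) + W_Φ(Λ)`).
[cite: BratteliKishimotoRobinson1978, §3 (H̃_Φ(Λ), W_Φ(Λ), p. 47)] -/
theorem localHamiltonian_restrict_eq_embedOp_add_far_add_cross (hΛ : Λ ⊆ Λ') :
    localHamiltonian (Φ.restrict Λ') univ =
      embedOp hΛ (localHamiltonian (Φ.restrict Λ) univ) +
        (∑ X ∈ Λ'.powerset with (¬ X ⊆ Λ ∧ Disjoint X Λ),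
          (if h : X ⊆ Λ' then embedOp h (Φ X) else 0)) +
        (∑ X ∈ Λ'.powerset with (¬ X ⊆ Λ ∧ ¬ Disjoint X Λ),
          (if h : X ⊆ Λ' then embedOp h (Φ X) else 0)) := by
  classical
  rw [localHamiltonian_restrict_eq_sum Φ Λ',
    ← Finset.sum_filter_add_sum_filter_not Λ'.powerset (fun X => X ⊆ Λ),
    ← Finset.sum_filter_add_sum_filter_not (Λ'.powerset.filter fun X => ¬ X ⊆ Λ)
      (fun X => Disjoint X Λ),
    Finset.filter_filter, Finset.filter_filter, add_assoc]
  congr 1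
  have hfilter : Λ'.powerset.filter (fun X => X ⊆ Λ) = Λ.powerset := by
    ext X
    simp only [Finset.mem_filter, Finset.mem_powerset]
    exact ⟨fun h => h.2, fun h => ⟨h.trans hΛ, h⟩⟩
  rw [hfilter, embedOp_localHamiltonian_restrict Φ hΛ]

/-- **Locality**: a term `Φ X` with `X ⊆ Λ'` disjoint from `Λ` commutes, inside `𝔄_{Λ'}`, with every
observable of `Λ` (observables of disjoint regions commute). [cite: BratteliRobinsonII1997, §6.2.1 (locality)] -/
theorem commute_embedOp_apply_of_disjoint {X : Finset (Site d)} (hX : X ⊆ Λ') (hΛ : Λ ⊆ Λ')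
    (hd : Disjoint X Λ) (A : Op ↥Λ q) : Commute (embedOp hX (Φ X)) (embedOp hΛ A) :=
  commute_embedOp_of_disjoint hX hΛ hd _ _

/-- The terms away from `Λ` commute with every observable of `Λ`.
[cite: BratteliRobinsonII1997, §6.2.1 (locality)] -/
theorem commute_farSum_embedOp (hΛ : Λ ⊆ Λ') (A : Op ↥Λ q) :
    Commute (∑ X ∈ Λ'.powerset with (¬ X ⊆ Λ ∧ Disjoint X Λ),
        (if h : X ⊆ Λ' then embedOp h (Φ X) else 0)) (embedOp hΛ A) := by
  refine Commute.sum_left _ _ _ fun X hX => ?_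
  rw [Finset.mem_filter, Finset.mem_powerset] at hX
  rw [dif_pos hX.1]
  exact Φ.commute_embedOp_apply_of_disjoint hX.1 hΛ hX.2.2 A

end LatticeInteraction

namespace InfVolState

variable {ω : InfVolState d q} {Φ : LatticeInteraction d q} {R : ℝ}

/-- **A ground state is locally `H_{Λ_R}`-stable** (real form of the defining inequality): for every
region `Λ` and `A ∈ 𝔄_Λ`, `Re ω((ΓA)⋆ (H_{Λ_R} ΓA - ΓA H_{Λ_R})) ≥ 0`, `Λ_R = thicken Λ R`,
`Γ = embedOp` (`-i ω(A⋆δ(A)) ≥ 0` with `δ(A) = i[H_{Λ_R}, ΓA]`).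
[cite: BratteliKishimotoRobinson1978, §1 (definition of τ-ground state)] -/
theorem IsGroundState.re_expect_conj_commutator_nonneg (hgs : ω.IsGroundState Φ R)
    (Λ : Finset (Site d)) (A : Op ↥Λ q) :
    0 ≤ (ω.expect (thicken Λ R) ((embedOp (subset_thicken Λ R) A)ᴴ *
      (localHamiltonian (Φ.restrict (thicken Λ R)) univ * embedOp (subset_thicken Λ R) A -
        embedOp (subset_thicken Λ R) A * localHamiltonian (Φ.restrict (thicken Λ R)) univ))).re := by
  have h := hgs Λ A
  rw [derivation, Matrix.mul_smul, map_smul, smul_eq_mul, ← mul_assoc,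
    show -Complex.I * Complex.I = 1 by rw [neg_mul, Complex.I_mul_I, neg_neg], one_mul] at h
  exact (Complex.nonneg_iff.1 h).1

open scoped Matrix.Norms.L2Operator in
/-- **Bratteli–Kishimoto–Robinson's principle of minimum local energy (Theorem 1, `2 ⇒ 1`), product
case, for a finite-range interaction of a quantum spin system.** If `ω` is a ground state of `Φ`
(`IsGroundState ω Φ R`) then for every finite region `Λ` and EVERY state `σ`,
`Re ω(H_Λ) ≤ Re σ(H_Λ) + 2 ‖W‖`, where `H_Λ = Σ_{X ⊆ Λ} Φ X` and
`W = Σ_{X ⊆ thicken Λ R, X ⊄ Λ, X ∩ Λ ≠ ∅} Φ X ⊗ 𝟙` is the interaction across `∂Λ`: the energy of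
`ω` in `Λ` is not lowered by replacing `ω` there by any other state (printed:
`ω(H̃(Λ)) = inf_{ω' ∈ C_Λ^ω} ω'(H̃(Λ))`, here for `ω' = σ_Λ ⊗ ω_{Λᶜ}` and with the surface energy
estimated by its norm). [cite: BratteliKishimotoRobinson1978, Thm. 1 (p. 43) and Thm. 2 (proof, pp. 47–48)] -/
theorem IsGroundState.re_expect_localHamiltonian_le (hgs : ω.IsGroundState Φ R)
    (σ : InfVolState d q) (Λ : Finset (Site d)) :
    (ω.expect Λ (localHamiltonian (Φ.restrict Λ) univ)).re ≤
      (σ.expect Λ (localHamiltonian (Φ.restrict Λ) univ)).re +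
      2 * ‖∑ X ∈ (thicken Λ R).powerset with (¬ X ⊆ Λ ∧ ¬ Disjoint X Λ),
        (if h : X ⊆ thicken Λ R then embedOp h (Φ X) else 0)‖ :=
  ω.re_expect_le_of_localStability_of_decomp (subset_thicken Λ R) σ
    (hgs.re_expect_conj_commutator_nonneg Λ)
    (Φ.localHamiltonian_restrict_eq_embedOp_add_far_add_cross (subset_thicken Λ R))
    (Φ.commute_farSum_embedOp (subset_thicken Λ R))

/-- **Ground states are stationary**: `ω([H_{Λ_R}, ΓB]) = 0` for every local `B ∈ 𝔄_Λ`
(`ω ∘ δ = 0` on the local algebra). Bratteli–Robinson II Prop. 5.3.19; Bratteli–Kishimoto–Robinson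
1978, §1 ("It follows that `ω` is `τ`-invariant"). [cite: BratteliRobinsonII1997, Prop. 5.3.19] -/
theorem IsGroundState.expect_commutator_localHamiltonian_eq_zero (hgs : ω.IsGroundState Φ R)
    (Λ : Finset (Site d)) (B : Op ↥Λ q) :
    ω.expect (thicken Λ R)
      (localHamiltonian (Φ.restrict (thicken Λ R)) univ * embedOp (subset_thicken Λ R) B -
        embedOp (subset_thicken Λ R) B * localHamiltonian (Φ.restrict (thicken Λ R)) univ) = 0 :=
  ω.expect_commutator_eq_zero_of_localStability (subset_thicken Λ R)
    (hgs.re_expect_conj_commutator_nonneg Λ) B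

end InfVolState

/-! ### §3. The mean energy of a translation-invariant state versus its local Hamiltonians -/

namespace LatticeInteraction

variable {Φ : LatticeInteraction d q} {R : ℝ}

/-- **Finite range, rooted form**: a region carrying a nonzero term of an interaction of range `R` lies
in the `R`-neighbourhood of each of its points. [cite: BratteliRobinsonII1997, §6.2.1 (finite range)] -/
theorem HasFiniteRange.subset_thicken_singleton (hR : Φ.HasFiniteRange R) {X : Finset (Site d)}
    (hX : Φ X ≠ 0) {y : Site d} (hy : y ∈ X) : X ⊆ thicken ({y} : Finset (Site d)) R :=
  hR.subset_thicken hX hy (Finset.mem_singleton_self y)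

/-- **Finite range restricts a rooted sum to the `R`-ball**: if `φ` vanishes on the regions carrying no
term, a sum of `φ` over the regions `X ∋ y` inside any `Λ' ⊇ thicken {y} R` equals the sum over the
regions inside the `R`-ball at `y`. [cite: BratteliRobinsonII1997, §6.2.1 (finite range)] -/
theorem HasFiniteRange.sum_filter_mem_eq_sum_thicken_singleton (hR : Φ.HasFiniteRange R)
    {M : Type*} [AddCommMonoid M] (φ : Finset (Site d) → M) (hφ : ∀ X, Φ X = 0 → φ X = 0)
    {y : Site d} {Λ' : Finset (Site d)} (h : thicken ({y} : Finset (Site d)) R ⊆ Λ') :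
    ∑ X ∈ Λ'.powerset with y ∈ X, φ X =
      ∑ X ∈ (thicken ({y} : Finset (Site d)) R).powerset with y ∈ X, φ X := by
  symm
  refine Finset.sum_subset (fun X hX => ?_) (fun X hX hX' => ?_)
  · rw [Finset.mem_filter, Finset.mem_powerset] at hX ⊢
    exact ⟨hX.1.trans h, hX.2⟩
  · rw [Finset.mem_filter, Finset.mem_powerset] at hX hX'
    exact hφ X (by_contra fun hne => hX' ⟨hR.subset_thicken_singleton hne hX.2, hX.2⟩)

open scoped Matrix.Norms.L2Operator in
/-- The terms of a translation-invariant interaction at translated regions have the same norm bound: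
`‖Φ (X + v)‖ ≤ ‖Φ X‖` (`Φ (X + v) = τ_v (Φ X)` and transport is contractive).
[cite: BratteliRobinsonII1997, §6.2.1 (eq. (6.2.3))] -/
theorem IsTranslationInvariant.norm_apply_shiftSet_le (hT : Φ.IsTranslationInvariant) (v : Site d)
    (X : Finset (Site d)) : ‖Φ (shiftSet v X)‖ ≤ ‖Φ X‖ := by
  rw [shiftSet_eq_map, hT v X]
  exact norm_transportOp_le _ _

open scoped Matrix.Norms.L2Operator in
/-- **Each site carries norm mass at most `S_Φ`**: for a translation-invariant interaction of finite
range `R`, `Σ_{X ⊆ Λ', X ∋ y} ‖Φ X‖ ≤ Σ_{X ⊆ thicken {0} R, X ∋ 0} ‖Φ X‖ =: S_Φ` for every site `y`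
and every finite `Λ'` (translate to the origin; `τ_y` is norm-contractive).
[cite: BratteliRobinsonII1997, §6.2.4 (the norm Σ_{X∋0} ‖Φ(X)‖)] -/
theorem IsTranslationInvariant.sum_filter_mem_norm_le (hT : Φ.IsTranslationInvariant)
    (hR : Φ.HasFiniteRange R) (y : Site d) (Λ' : Finset (Site d)) :
    ∑ X ∈ Λ'.powerset with y ∈ X, ‖Φ X‖ ≤
      ∑ X ∈ (thicken ({0} : Finset (Site d)) R).powerset with (0 : Site d) ∈ X, ‖Φ X‖ := by
  calc ∑ X ∈ Λ'.powerset with y ∈ X, ‖Φ X‖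
      ≤ ∑ X ∈ (Λ' ∪ thicken ({y} : Finset (Site d)) R).powerset with y ∈ X, ‖Φ X‖ :=
        Finset.sum_le_sum_of_subset_of_nonneg
          (Finset.filter_subset_filter _ (Finset.powerset_mono.2 Finset.subset_union_left))
          fun _ _ _ => norm_nonneg _
    _ = ∑ X ∈ (thicken ({y} : Finset (Site d)) R).powerset with y ∈ X, ‖Φ X‖ :=
        hR.sum_filter_mem_eq_sum_thicken_singleton _ (fun X hX => by rw [hX, norm_zero])
          Finset.subset_union_right
    _ = ∑ X ∈ (thicken ({0} : Finset (Site d)) R).powerset with (0 : Site d) ∈ X,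
          ‖Φ (shiftSet y X)‖ := sum_thicken_singleton_eq_sum_shiftSet _ y R
    _ ≤ _ := Finset.sum_le_sum fun X _ => hT.norm_apply_shiftSet_le y X

open scoped Matrix.Norms.L2Operator in
/-- **The terms not inside `Λ` have total norm at most `|collar| · S_Φ`**:
`Σ_{X ⊆ thicken Λ R, X ⊄ Λ} ‖Φ X‖ ≤ |thicken Λ R ∖ Λ| · S_Φ`.
[cite: BratteliKishimotoRobinson1978, §3 (surface energy W_Φ(Λ), p. 47)] -/
theorem IsTranslationInvariant.sum_filter_not_subset_norm_le (hT : Φ.IsTranslationInvariant)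
    (hR : Φ.HasFiniteRange R) (Λ : Finset (Site d)) :
    ∑ X ∈ (thicken Λ R).powerset with ¬ X ⊆ Λ, ‖Φ X‖ ≤
      ((thicken Λ R \ Λ).card : ℝ) *
        ∑ X ∈ (thicken ({0} : Finset (Site d)) R).powerset with (0 : Site d) ∈ X, ‖Φ X‖ := by
  refine (sum_filter_not_subset_le_sum_sdiff_sum Λ (thicken Λ R) (fun X => ‖Φ X‖)
    fun _ => norm_nonneg _).trans ?_
  refine (Finset.sum_le_sum fun y _ => hT.sum_filter_mem_norm_le hR y (thicken Λ R)).trans ?_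
  rw [Finset.sum_const, nsmul_eq_mul]

open scoped Matrix.Norms.L2Operator in
/-- **The surface energy is carried by the collar**: the interaction across `∂Λ`,
`W_Λ = Σ_{X ⊆ thicken Λ R, X ⊄ Λ, X ∩ Λ ≠ ∅} Φ X ⊗ 𝟙` (in `𝔄_{thicken Λ R}`, the `W` of
`IsGroundState.re_expect_localHamiltonian_le`), has `‖W_Λ‖ ≤ |thicken Λ R ∖ Λ| · S_Φ`.
[cite: BratteliKishimotoRobinson1978, §3 (W_Φ(Λ), p. 47) and Thm. 2 (proof, p. 48)] -/
theorem IsTranslationInvariant.norm_crossSum_le (hT : Φ.IsTranslationInvariant)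
    (hR : Φ.HasFiniteRange R) (Λ : Finset (Site d)) :
    ‖∑ X ∈ (thicken Λ R).powerset with (¬ X ⊆ Λ ∧ ¬ Disjoint X Λ),
        (if h : X ⊆ thicken Λ R then embedOp h (Φ X) else (0 : Op ↥(thicken Λ R) q))‖ ≤
      ((thicken Λ R \ Λ).card : ℝ) *
        ∑ X ∈ (thicken ({0} : Finset (Site d)) R).powerset with (0 : Site d) ∈ X, ‖Φ X‖ := by
  refine (norm_sum_le _ _).trans (le_trans ?_ (hT.sum_filter_not_subset_norm_le hR Λ))
  calc ∑ X ∈ (thicken Λ R).powerset with (¬ X ⊆ Λ ∧ ¬ Disjoint X Λ),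
        ‖(if h : X ⊆ thicken Λ R then embedOp h (Φ X) else (0 : Op ↥(thicken Λ R) q))‖
      ≤ ∑ X ∈ (thicken Λ R).powerset with (¬ X ⊆ Λ ∧ ¬ Disjoint X Λ), ‖Φ X‖ :=
        Finset.sum_le_sum fun X hX => by
          rw [Finset.mem_filter, Finset.mem_powerset] at hX
          rw [dif_pos hX.1]
          exact norm_embedOp_le _ _
    _ ≤ _ := Finset.sum_le_sum_of_subset_of_nonneg (fun X hX => by
          rw [Finset.mem_filter] at hX ⊢
          exact ⟨hX.1, hX.2.1⟩) fun _ _ _ => norm_nonneg _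

end LatticeInteraction

namespace InfVolState

variable {Φ : LatticeInteraction d q} {R : ℝ} {ω : InfVolState d q}

/-- **The local algebra of the empty region is `ℂ`**: `ω_∅(A) = A_{σ₀σ₀}` (`σ₀` the unique, empty,
configuration) for every state — the expectation of an observable of the empty region does not depend
on the state. [cite: BratteliRobinsonI1987, Def. 2.6.3 (𝔄_∅ = ℂ𝟙)] -/
theorem expect_empty_eq (ω : InfVolState d q) (A : Op ↥(∅ : Finset (Site d)) q) :
    ω.expect ∅ A = A default default := by
  have hA : A = A default default • (1 : Op ↥(∅ : Finset (Site d)) q) := by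
    ext s t
    rw [Unique.eq_default s, Unique.eq_default t, Matrix.smul_apply, Matrix.one_apply_eq,
      smul_eq_mul, mul_one]
  conv_lhs => rw [hA]
  rw [map_smul, ω.expect_one, smul_eq_mul, mul_one]

/-- The expectation of the local Hamiltonian is the sum of the term energies:
`ω(H_Λ) = Σ_{X ⊆ Λ} ω_X(Φ X)`. [cite: BratteliRobinsonII1997, §6.2.1 (H_Φ(Λ) = Σ_{X⊆Λ} Φ(X))] -/
theorem expect_localHamiltonian_eq_sum (ω : InfVolState d q) (Φ : LatticeInteraction d q)
    (Λ : Finset (Site d)) :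
    ω.expect Λ (localHamiltonian (Φ.restrict Λ) univ) = ∑ X ∈ Λ.powerset, ω.expect X (Φ X) := by
  rw [localHamiltonian_restrict_eq_sum, map_sum]
  refine Finset.sum_congr rfl fun X hX => ?_
  rw [Finset.mem_powerset] at hX
  rw [dif_pos hX, ω.compatible hX]

/-- **Translation invariance of `ω` and `Φ`**: the energy of the translated term is the energy of the
term, `ω(Φ(X + v)) = ω(Φ X)`. [cite: BratteliKishimotoRobinson1978, Thm. 2 (ℤ^ν-invariant Φ and ω)] -/
theorem IsTranslationInvariant.expect_apply_shiftSet (hω : ω.IsTranslationInvariant)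
    (hT : Φ.IsTranslationInvariant) (v : Site d) (X : Finset (Site d)) :
    ω.expect (shiftSet v X) (Φ (shiftSet v X)) = ω.expect X (Φ X) := by
  rw [shiftSet_eq_map, hT v X]
  conv_rhs => rw [← hω v, shift_expect]

/-- The expectation of the mean-energy observable is the weighted sum of the energies of the terms at
the origin: `σ(E_Φ) = Σ_{X ∋ 0, X ⊆ thicken {0} R} |X|⁻¹ σ_X(Φ X)`.
[cite: BratteliKishimotoRobinson1978, §3 (mean energy functional)] -/
theorem expect_meanEnergyObs (Φ : LatticeInteraction d q) (R : ℝ) (σ : InfVolState d q) :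
    σ.expect _ (meanEnergyObs Φ R) =
      ∑ X ∈ (thicken ({0} : Finset (Site d)) R).powerset with (0 : Site d) ∈ X,
        ((X.card : ℂ)⁻¹) * σ.expect X (Φ X) := by
  classical
  set Λ₀ : Finset (Site d) := thicken ({0} : Finset (Site d)) R with hΛ₀
  rw [meanEnergyObs, map_sum]
  refine Finset.sum_nbij' (fun X' => X'.map (Function.Embedding.subtype (· ∈ Λ₀)))
    (fun X => X.subtype (· ∈ Λ₀)) ?_ ?_ ?_ ?_ ?_
  · intro X' hX'
    rw [Finset.mem_filter] at hX'
    rw [Finset.mem_filter, Finset.mem_powerset]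
    refine ⟨map_subtype_subset_ambient X', ?_⟩
    rw [Finset.mem_map]
    exact ⟨⟨0, zero_mem_thicken_zero R⟩, hX'.2, rfl⟩
  · intro X hX
    rw [Finset.mem_filter, Finset.mem_powerset] at hX
    rw [Finset.mem_filter]
    exact ⟨Finset.mem_powerset.2 (Finset.subset_univ _), Finset.mem_subtype.2 hX.2⟩
  · intro X' _
    ext y
    simp
  · intro X hX
    rw [Finset.mem_filter, Finset.mem_powerset] at hX
    exact Finset.subtype_map_of_mem fun x hx => hX.1 hx
  · intro X' _
    rw [map_smul, Φ.restrict_apply_eq_embedOp Λ₀ X', σ.compatible, Finset.card_map, smul_eq_mul]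

/-- **The weighted term energies through any site sum to the mean energy**: for translation-invariant
`ω` and `Φ` (range `R`) and every `Λ' ⊇ thicken {x} R`,
`Σ_{Y ⊆ Λ', Y ∋ x} |Y|⁻¹ ω(Φ Y) = ω(E_Φ)` (`E_Φ = Σ_{X ∋ 0} Φ X/|X|`; re-root at `0`).
[cite: BratteliRobinsonII1997, §6.2.4 (mean energy)] -/
theorem IsTranslationInvariant.sum_filter_mem_card_inv_mul_expect_eq (hω : ω.IsTranslationInvariant)
    (hT : Φ.IsTranslationInvariant) (hR : Φ.HasFiniteRange R) {x : Site d} {Λ' : Finset (Site d)}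
    (h : thicken ({x} : Finset (Site d)) R ⊆ Λ') :
    ∑ Y ∈ Λ'.powerset with x ∈ Y, ((Y.card : ℂ)⁻¹ * ω.expect Y (Φ Y)) =
      ω.expect _ (meanEnergyObs Φ R) := by
  rw [hR.sum_filter_mem_eq_sum_thicken_singleton _ (fun Y hY => by rw [hY, map_zero, mul_zero]) h,
    sum_thicken_singleton_eq_sum_shiftSet, expect_meanEnergyObs]
  refine Finset.sum_congr rfl fun X _ => ?_
  rw [card_shiftSet, hω.expect_apply_shiftSet hT]

/-- **The exact identity**: for translation-invariant `ω` and `Φ` (range `R`) and every finite `Λ`,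
`|Λ| · ω(E_Φ) = Σ_{Y ⊆ thicken Λ R} |Y ∩ Λ| · |Y|⁻¹ ω(Φ Y)` (sum the previous identity over `x ∈ Λ`
and count every region `|Y ∩ Λ|` times). [cite: BratteliRobinsonII1997, §6.2.4 (mean energy)] -/
theorem IsTranslationInvariant.card_mul_expect_meanEnergyObs_eq (hω : ω.IsTranslationInvariant)
    (hT : Φ.IsTranslationInvariant) (hR : Φ.HasFiniteRange R) (Λ : Finset (Site d)) :
    (Λ.card : ℂ) * ω.expect _ (meanEnergyObs Φ R) =
      ∑ Y ∈ (thicken Λ R).powerset, ((Y ∩ Λ).card : ℂ) * ((Y.card : ℂ)⁻¹ * ω.expect Y (Φ Y)) := by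
  have h1 : (Λ.card : ℂ) * ω.expect _ (meanEnergyObs Φ R) =
      ∑ x ∈ Λ, ∑ Y ∈ (thicken Λ R).powerset with x ∈ Y, ((Y.card : ℂ)⁻¹ * ω.expect Y (Φ Y)) := by
    rw [Finset.sum_congr rfl fun x hx => hω.sum_filter_mem_card_inv_mul_expect_eq hT hR
      (thicken_subset_thicken_of_subset (Finset.singleton_subset_iff.2 hx) R), Finset.sum_const,
      nsmul_eq_mul]
  rw [h1, sum_sum_filter_mem_eq_sum_card_inter_smul]
  simp_rw [nsmul_eq_mul]

/-- **The part inside `Λ` is the local Hamiltonian, up to the constant term**: the difference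
`|Λ| ω(E_Φ) − (ω(H_Λ) − ω(Φ ∅))` is the sum over the regions `Y ⊆ thicken Λ R` NOT inside `Λ` of
`|Y ∩ Λ| |Y|⁻¹ ω(Φ Y)`. [cite: BratteliRobinsonII1997, §6.2.4 (mean energy)] -/
theorem IsTranslationInvariant.card_mul_expect_meanEnergyObs_sub_eq (hω : ω.IsTranslationInvariant)
    (hT : Φ.IsTranslationInvariant) (hR : Φ.HasFiniteRange R) (Λ : Finset (Site d)) :
    (Λ.card : ℂ) * ω.expect _ (meanEnergyObs Φ R) -
        (ω.expect Λ (localHamiltonian (Φ.restrict Λ) univ) - ω.expect ∅ (Φ ∅)) =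
      ∑ Y ∈ (thicken Λ R).powerset with ¬ Y ⊆ Λ,
        ((Y ∩ Λ).card : ℂ) * ((Y.card : ℂ)⁻¹ * ω.expect Y (Φ Y)) := by
  rw [hω.card_mul_expect_meanEnergyObs_eq hT hR Λ,
    ← Finset.sum_filter_add_sum_filter_not _ (fun Y => Y ⊆ Λ)]
  have hfilter : (thicken Λ R).powerset.filter (fun Y => Y ⊆ Λ) = Λ.powerset := by
    ext X
    simp only [Finset.mem_filter, Finset.mem_powerset]
    exact ⟨fun h => h.2, fun h => ⟨h.trans (subset_thicken Λ R), h⟩⟩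
  have hA : ∑ Y ∈ (thicken Λ R).powerset with Y ⊆ Λ,
      ((Y ∩ Λ).card : ℂ) * ((Y.card : ℂ)⁻¹ * ω.expect Y (Φ Y)) =
        ω.expect Λ (localHamiltonian (Φ.restrict Λ) univ) - ω.expect ∅ (Φ ∅) := by
    rw [hfilter, expect_localHamiltonian_eq_sum]
    have hdiff : ∑ Y ∈ Λ.powerset, (ω.expect Y (Φ Y) -
        ((Y ∩ Λ).card : ℂ) * ((Y.card : ℂ)⁻¹ * ω.expect Y (Φ Y))) =
        ω.expect ∅ (Φ ∅) - (((∅ : Finset (Site d)) ∩ Λ).card : ℂ) *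
          ((((∅ : Finset (Site d))).card : ℂ)⁻¹ * ω.expect ∅ (Φ ∅)) := by
      refine Finset.sum_eq_single_of_mem _ (Finset.empty_mem_powerset Λ) fun Y hY hne => ?_
      rw [Finset.mem_powerset] at hY
      have hc : (Y.card : ℂ) ≠ 0 :=
        Nat.cast_ne_zero.2 (Finset.card_ne_zero.2 (Finset.nonempty_iff_ne_empty.2 hne))
      rw [Finset.inter_eq_left.2 hY, mul_inv_cancel_left₀ hc, sub_self]
    rw [Finset.empty_inter, Finset.card_empty, Nat.cast_zero, zero_mul, sub_zero,
      Finset.sum_sub_distrib] at hdiff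
    rw [← hdiff]
    abel
  rw [hA]
  abel

open scoped Matrix.Norms.L2Operator in
/-- The regions not inside `Λ` contribute at most their norms: `|Y ∩ Λ| ≤ |Y|`, `|ω(Φ Y)| ≤ ‖Φ Y‖`.
[cite: BratteliRobinsonI1987, Prop. 2.3.11 (states are contractive)] -/
theorem norm_sum_filter_not_subset_le (ω : InfVolState d q) (Φ : LatticeInteraction d q)
    (Λ Λ' : Finset (Site d)) :
    ‖∑ Y ∈ Λ'.powerset with ¬ Y ⊆ Λ, ((Y ∩ Λ).card : ℂ) * ((Y.card : ℂ)⁻¹ * ω.expect Y (Φ Y))‖ ≤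
      ∑ Y ∈ Λ'.powerset with ¬ Y ⊆ Λ, ‖Φ Y‖ := by
  refine (norm_sum_le _ _).trans (Finset.sum_le_sum fun Y hY => ?_)
  rw [Finset.mem_filter, Finset.mem_powerset] at hY
  have hne : Y.Nonempty :=
    Finset.nonempty_of_ne_empty (by rintro rfl; exact hY.2 (Finset.empty_subset _))
  have hc : (0 : ℝ) < Y.card := by exact_mod_cast hne.card_pos
  rw [norm_mul, norm_mul, norm_inv, Complex.norm_natCast, Complex.norm_natCast]
  have hcard : ((Y ∩ Λ).card : ℝ) ≤ Y.card := by
    exact_mod_cast Finset.card_le_card Finset.inter_subset_left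
  calc ((Y ∩ Λ).card : ℝ) * ((Y.card : ℝ)⁻¹ * ‖ω.expect Y (Φ Y)‖)
      ≤ (Y.card : ℝ) * ((Y.card : ℝ)⁻¹ * ‖Φ Y‖) :=
        mul_le_mul hcard
          (mul_le_mul_of_nonneg_left (ω.norm_expect_le_holds Y (Φ Y)) (inv_nonneg.2 hc.le))
          (by positivity) (by positivity)
    _ = ‖Φ Y‖ := mul_inv_cancel_left₀ hc.ne' _

open scoped Matrix.Norms.L2Operator in
/-- **The mean energy versus the free-boundary local Hamiltonians** (Bratteli–Robinson II §6.2.4 in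
finite-range, free-boundary form with an explicit collar error): for a translation-invariant state `ω`,
a translation-invariant interaction `Φ` of finite range `R`, and every finite region `Λ`,
`| |Λ| · e_Φ(ω) − (Re ω(H_Λ) − Re ω(Φ ∅)) | ≤ |thicken Λ R ∖ Λ| · S_Φ`,
`S_Φ = Σ_{X ∋ 0, X ⊆ thicken {0} R} ‖Φ X‖`. [cite: BratteliRobinsonII1997, §6.2.4]
[cite: BratteliKishimotoRobinson1978, §3 (H_Φ(ω) = lim ω(H_Φ(Λ))/|Λ|, p. 47)] -/
theorem IsTranslationInvariant.abs_card_mul_meanEnergy_sub_le (hω : ω.IsTranslationInvariant)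
    (hT : Φ.IsTranslationInvariant) (hR : Φ.HasFiniteRange R) (Λ : Finset (Site d)) :
    |(Λ.card : ℝ) * ω.meanEnergy Φ R -
        ((ω.expect Λ (localHamiltonian (Φ.restrict Λ) univ)).re - (ω.expect ∅ (Φ ∅)).re)| ≤
      ((thicken Λ R \ Λ).card : ℝ) *
        ∑ X ∈ (thicken ({0} : Finset (Site d)) R).powerset with (0 : Site d) ∈ X, ‖Φ X‖ := by
  have h := congrArg Complex.re (hω.card_mul_expect_meanEnergyObs_sub_eq hT hR Λ)
  rw [Complex.sub_re, Complex.sub_re, ← Complex.ofReal_natCast, Complex.re_ofReal_mul] at h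
  rw [meanEnergy, h]
  exact (Complex.abs_re_le_norm _).trans
    ((ω.norm_sum_filter_not_subset_le Φ Λ _).trans (hT.sum_filter_not_subset_norm_le hR Λ))

/-! ### §4. Translation-invariant ground states minimise the mean energy -/

open scoped Matrix.Norms.L2Operator in
/-- **Bratteli–Kishimoto–Robinson Theorem 2, `1 ⇒ 2`, in finite volume.** If `ω` is a
translation-invariant ground state of the translation-invariant, finite-range (`R`) interaction `Φ`,
then for every translation-invariant state `σ` and every finite region `Λ`:
`|Λ| e_Φ(ω) ≤ |Λ| e_Φ(σ) + 4 |thicken Λ R ∖ Λ| S_Φ` (principle of minimum local energy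
`Re ω(H_Λ) ≤ Re σ(H_Λ) + 2 ‖W_Λ‖`, `‖W_Λ‖ ≤ |collar| S_Φ`, and §3 for `ω` and `σ`; the constant terms
`ω(Φ ∅) = σ(Φ ∅)` cancel). [cite: BratteliKishimotoRobinson1978, Thm. 2 (proof, pp. 47–48)] -/
theorem IsGroundState.card_mul_meanEnergy_le (hgs : ω.IsGroundState Φ R)
    (hT : Φ.IsTranslationInvariant) (hR : Φ.HasFiniteRange R) (hω : ω.IsTranslationInvariant)
    {σ : InfVolState d q} (hσ : σ.IsTranslationInvariant) (Λ : Finset (Site d)) :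
    (Λ.card : ℝ) * ω.meanEnergy Φ R ≤ (Λ.card : ℝ) * σ.meanEnergy Φ R +
      4 * (((thicken Λ R \ Λ).card : ℝ) *
        ∑ X ∈ (thicken ({0} : Finset (Site d)) R).powerset with (0 : Site d) ∈ X, ‖Φ X‖) := by
  have h1 := hω.abs_card_mul_meanEnergy_sub_le hT hR Λ
  have h2 := hσ.abs_card_mul_meanEnergy_sub_le hT hR Λ
  have hloc := hgs.re_expect_localHamiltonian_le σ Λ
  have hW := hT.norm_crossSum_le hR Λ
  have h0 : ω.expect ∅ (Φ ∅) = σ.expect ∅ (Φ ∅) := by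
    rw [ω.expect_empty_eq, σ.expect_empty_eq]
  rw [h0] at h1
  rw [abs_le] at h1 h2
  linarith [h1.1, h1.2, h2.1, h2.2]

open scoped Matrix.Norms.L2Operator in
/-- **Bratteli–Kishimoto–Robinson Theorem 2, `1 ⇒ 2`: the mean energy of a translation-invariant
ground state is minimal.** For a translation-invariant interaction `Φ` of finite range `R` on the
quantum spin system `ℤ^d`, a translation-invariant ground state `ω` of `Φ` and any translation-invariant
state `σ`: `e_Φ(ω) ≤ e_Φ(σ)` (the finite-volume inequality on the boxes `[0,L)^d`, whose collars have
`≤ (L + 2⌊R⌋)^d − L^d = o(L^d)` sites, and `L → ∞`).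
[cite: BratteliKishimotoRobinson1978, Thm. 2 (p. 47), proof pp. 47–48] -/
theorem IsGroundState.meanEnergy_le (hgs : ω.IsGroundState Φ R) (hT : Φ.IsTranslationInvariant)
    (hR : Φ.HasFiniteRange R) (hω : ω.IsTranslationInvariant) {σ : InfVolState d q}
    (hσ : σ.IsTranslationInvariant) : ω.meanEnergy Φ R ≤ σ.meanEnergy Φ R := by
  set S : ℝ := ∑ X ∈ (thicken ({0} : Finset (Site d)) R).powerset with (0 : Site d) ∈ X, ‖Φ X‖
    with hS
  have hS0 : 0 ≤ S := Finset.sum_nonneg fun _ _ => norm_nonneg _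
  set r : ℕ := ⌊R⌋₊ with hr
  -- the inequality on the box `[0,L)^d`
  have hbox : ∀ L : ℕ, (L : ℝ) ^ d * ω.meanEnergy Φ R ≤
      (L : ℝ) ^ d * σ.meanEnergy Φ R + 4 * ((((L + 2 * r : ℕ) : ℝ) ^ d - (L : ℝ) ^ d) * S) := by
    intro L
    have h := hgs.card_mul_meanEnergy_le hT hR hω hσ (halfOpenBox d L)
    rw [card_halfOpenBox, Nat.cast_pow] at h
    have hc : ((thicken (halfOpenBox d L) R \ halfOpenBox d L).card : ℝ) ≤
        ((L + 2 * r : ℕ) : ℝ) ^ d - (L : ℝ) ^ d := by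
      have h' := card_thicken_halfOpenBox_sdiff_le (d := d) L R
      have hle : L ^ d ≤ (L + 2 * r) ^ d := Nat.pow_le_pow_left (Nat.le_add_right _ _) d
      rw [← Nat.cast_pow, ← Nat.cast_pow, ← Nat.cast_sub hle]
      exact_mod_cast h'
    nlinarith [hc, hS0]
  -- `L → ∞`
  by_contra hcon
  push Not at hcon
  have hδ0 : 0 < ω.meanEnergy Φ R - σ.meanEnergy Φ R := sub_pos.2 hcon
  have hlim : Tendsto (fun L : ℕ => 4 * (((1 + 2 * (r : ℝ) / L) ^ d - 1) * S)) atTop (𝓝 0) := by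
    have h1 : Tendsto (fun L : ℕ => 2 * (r : ℝ) / L) atTop (𝓝 0) :=
      tendsto_const_div_atTop_nhds_zero_nat _
    have h2 := (((tendsto_const_nhds (x := (1 : ℝ))).add h1).pow d |>.sub_const 1
      |>.mul_const S).const_mul 4
    simpa using h2
  obtain ⟨L, hL1, hL2⟩ :=
    ((Filter.eventually_gt_atTop 0).and (hlim.eventually (gt_mem_nhds hδ0))).exists
  have hLpos : (0 : ℝ) < L := by exact_mod_cast hL1
  have hb := hbox L
  have hexp : ((L + 2 * r : ℕ) : ℝ) ^ d - (L : ℝ) ^ d =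
      (L : ℝ) ^ d * ((1 + 2 * (r : ℝ) / L) ^ d - 1) := by
    have h' : ((L + 2 * r : ℕ) : ℝ) = (L : ℝ) * (1 + 2 * (r : ℝ) / L) := by
      push_cast
      field_simp
    rw [h', mul_pow]
    ring
  rw [hexp] at hb
  have hLd : (0 : ℝ) < (L : ℝ) ^ d := pow_pos hLpos d
  nlinarith [mul_lt_mul_of_pos_left hL2 hLd]

/-- **Bratteli–Kishimoto–Robinson 1978, Theorem 2 (`1 ⇒ 2`) for quantum spin systems: every
translation-invariant ground state of a translation-invariant finite-range interaction minimises the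
mean energy** among the translation-invariant states (`IsMeanEnergyMinimiser`). No Hermiticity and no
restriction on `d` or `q` is needed for this direction. [cite: BratteliKishimotoRobinson1978, Thm. 2 (p. 47)]
[cite: BratteliRobinsonII1997, Thm. 6.2.58] -/
theorem IsGroundState.isMeanEnergyMinimiser (hgs : ω.IsGroundState Φ R) (hR : Φ.HasFiniteRange R)
    (hT : Φ.IsTranslationInvariant) (hω : ω.IsTranslationInvariant) :
    ω.IsMeanEnergyMinimiser Φ R :=
  ⟨hω, fun _ hσ => hgs.meanEnergy_le hT hR hω hσ⟩

end InfVolState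

end Literature.MathematicalPhysics.QuantumLattice

end
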